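import Summits.CriticalPhenomena.SAWScalingLimit.Theses.SAWDefectDecoherence

/-!
# drefute g2 scratch — shape of a renewal-abundance statement that survives the fixed-foliation
# obstruction (`Negative-notes/RenewalAccumulation-g2.md` §5–6): DOMAIN-ADAPTED, PAIRWISE-DISJOINT
# gate families (`RenewalAccumulationAdapted`, "RA‴")

`rowCoord`, `rowOf`, `skewCoord`, `gatePoint`, `HasCleanWindow` are copied VERBATIM from
`Cruxes/ObservableToSLER/Lines/bridge-gate-renewal.lean`.  New: `cutSide`, `cutSideVerts`,
`IsLatticeCarrier`, `IsAdmissibleFamily`, `IsCrossedOnce`, `GoodGateIn`, `RenewalAccumulationAdapted`,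
the definitional lemma `goodGateIn_mono` (a larger admissible family only helps), and the PROVED
topological `nesting` lemma (`U(κ') ⊆ U(κ)` for disjoint connected relatively-closed cuts, `κ`
two-sided with `far` beyond it, `κ'` separating and meeting `U(κ)`; axioms standard) — the one
geometric input of the product-cell step of stub 6 for any admissible family.

Differences to the line's `RenewalAccumulation` / gen-1's `RenewalAccumulationSep`:
* the crosscut `κ` is no longer the level-hexagon arc through the first-exit edge but ANY member
  of a family `F` of subsets of `Ω` chosen by the prover AFTER `δ` (`∃ F` under `∀ᶠ δ`): members
  are connected, lie on mesh `𝕋`-lines (so the clean flat window at the crossing edge makes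
  sense), are pairwise DISJOINT (this alone gives gen-1's nesting lemma, hence prefix-determined
  minimality and product cells for stub 6), SEPARATE the root from the far endpoint, and have a
  LOCAL root side `U(κ) ∪ κ ⊆ B(δ·ĉ, R)` (replaces the level window `[r, R]`; needed by stub 6 (iv)
  and by Radó in stub 5; the lower scale is automatic from the clean window radius `ρ`);
* the root side `U(κ)` is the component of `Ω ∖ κ` containing the rescaled ROOT `δ·ĉ` (walk
  independent), not the component of the crossing edge's inner vertex.
Hexagon level arcs (flat/bulk zones) and straight transversal lattice chords (channel zones) are
both admissible members; the abundance of single crossings for a well-zoned family is the new bet.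
-/

noncomputable section

open scoped BigOperators Topology NNReal ENNReal Classical
open Filter Set MeasureTheory Metric
open Literature.Probability.LatticeModels (HexVertex hexGraph hexCenter triZeta Site)
open Literature.Probability.RandomPlanarGeometry
open Literature.Probability.RandomPlanarGeometry.SAW

namespace Summit.CriticalPhenomena.SAWScalingLimit.Cruxes.ObservableToSLER.DrefuteRA3

/-! ## Vocabulary (verbatim copy of the line's block, the part that is reused) -/

def rowCoord (i : Fin 3) (v : HexVertex) : ℤ :=
  if i = 0 then v.1 1 else if i = 1 then v.1 0 else v.1 0 + v.1 1 + (v.2 : ℕ)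

def rowOf (k : Fin 6) (v : HexVertex) : ℤ :=
  ![rowCoord 0 v, -rowCoord 1 v, -rowCoord 2 v, -rowCoord 0 v, rowCoord 1 v, rowCoord 2 v] k

def skewCoord (i : Fin 3) (z : ℂ) : ℝ :=
  ![2 * z.im / Real.sqrt 3, z.re - z.im / Real.sqrt 3, z.re + z.im / Real.sqrt 3] i

def gatePoint (δ : ℝ) (p q : HexVertex) : ℂ :=
  (δ : ℂ) * (hexCenter p + hexCenter q) / 2

def HasCleanWindow (Ω : Set ℂ) (δ ρ : ℝ) (S : Set HexVertex) (p q : HexVertex) : Prop :=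
  closedBall ((δ : ℂ) * hexCenter q) ρ ⊆ Ω ∧
    ∃ k : Fin 6, rowOf k q = rowOf k p + 1 ∧
      ∀ x : HexVertex, (δ : ℂ) * hexCenter x ∈ ball ((δ : ℂ) * hexCenter q) ρ →
        (x ∈ S ↔ rowOf k x ≤ rowOf k p)

/-! ## Adapted gates -/

/-- The ROOT SIDE of a cut `κ ⊆ Ω`: the connected component of `Ω ∖ κ` containing the rescaled
root vertex `c` (walk-independent). -/
def cutSide (Ω κ : Set ℂ) (δ : ℝ) (c : HexVertex) : Set ℂ :=
  connectedComponentIn (Ω \ κ) ((δ : ℂ) * hexCenter c)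

/-- Lattice shadow of the root side. -/
def cutSideVerts (Ω κ : Set ℂ) (δ : ℝ) (c : HexVertex) : Set HexVertex :=
  {v | (δ : ℂ) * hexCenter v ∈ cutSide Ω κ δ c}

/-- `κ` lies on `𝕋`-lines of mesh `δ` (hexagon level arcs and straight lattice chords both do):
then a dual edge `{p,q}` crosses `κ` iff its gate point lies on `κ`, and flat windows make sense. -/
def IsLatticeCarrier (δ : ℝ) (κ : Set ℂ) : Prop :=
  ∀ z ∈ κ, ∃ i : Fin 3, ∃ m : ℤ, skewCoord i (z / δ) = (m : ℝ)

/-- An ADMISSIBLE GATE FAMILY for the root `c` against the far endpoint `far` at locality scale `R`: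
pairwise disjoint, connected, relatively closed, lattice-carried cuts inside `Ω`, each TWO-SIDED
(the complement of the root side `U(κ)` in `Ω ∖ κ` is connected — a genuine crosscut, no dangling
hair), each separating `δ·ĉ` from `δ·far̂`, each with `U(κ) ∪ κ` inside the `R`-ball about the
root.  (Disjoint + connected + separating is exactly what gen-1's nesting lemma consumes:
`κ' ∩ κ = ∅`, `κ'` meets `U(κ)` ⇒ `κ' ⊆ U(κ)` ⇒ `U(κ') ⊆ U(κ)`, so "first good gate of `F`" is
prefix-determined and the cells of stub 6 are products.) -/
def IsAdmissibleFamily (Ω : Set ℂ) (δ R : ℝ) (c far : HexVertex) (F : Set (Set ℂ)) : Prop :=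
  F.PairwiseDisjoint id ∧
    ∀ κ ∈ F, κ ⊆ Ω ∧ IsConnected κ ∧ closure κ ∩ Ω ⊆ κ ∧ IsLatticeCarrier δ κ ∧
      IsConnected ((Ω \ κ) \ cutSide Ω κ δ c) ∧
      (δ : ℂ) * hexCenter far ∈ (Ω \ κ) \ cutSide Ω κ δ c ∧
      cutSide Ω κ δ c ∪ κ ⊆ ball ((δ : ℂ) * hexCenter c) R

/-- `l` CROSSES `κ` EXACTLY ONCE, at index `m` through the dual edge `{p,q} = {l[m-1], l[m]}`
whose gate point lies on `κ`, with prefix in the root side, suffix off it, and a clean flat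
`ρ`-window at the crossing. -/
def IsCrossedOnce (Ω : Set ℂ) (δ ρ : ℝ) (c : HexVertex) (κ : Set ℂ) (l : List HexVertex) (m : ℕ)
    (p q : HexVertex) : Prop :=
  (l.take m).getLast? = some p ∧ (l.drop m).head? = some q ∧ gatePoint δ p q ∈ κ ∧
    (∀ v ∈ l.take m, v ∈ cutSideVerts Ω κ δ c) ∧ (∀ v ∈ l.drop m, v ∉ cutSideVerts Ω κ δ c) ∧
    HasCleanWindow Ω δ ρ (cutSideVerts Ω κ δ c) p q

/-- `l` has a good gate in the family `F`. -/
def GoodGateIn (Ω : Set ℂ) (δ ρ : ℝ) (c : HexVertex) (F : Set (Set ℂ)) (l : List HexVertex) : Prop :=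
  ∃ κ ∈ F, ∃ (m : ℕ) (p q : HexVertex), IsCrossedOnce Ω δ ρ c κ l m p q

/-- A larger family only helps (definitional). -/
theorem goodGateIn_mono {Ω : Set ℂ} {δ ρ : ℝ} {c : HexVertex} {F F' : Set (Set ℂ)} (h : F ⊆ F')
    {l : List HexVertex} (hl : GoodGateIn Ω δ ρ c F l) : GoodGateIn Ω δ ρ c F' l := by
  obtain ⟨κ, hκ, m, p, q, hx⟩ := hl
  exact ⟨κ, h hκ, m, p, q, hx⟩

/-- **RA‴ — RENEWAL ABUNDANCE OVER DOMAIN-ADAPTED DISJOINT GATE FAMILIES.**  For every Dobrushin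
domain, endpoint approximation, `ε > 0` and locality scale `R > 0` there is a window radius `ρ > 0`
such that for all small meshes THERE EXIST admissible gate families `Fa` (root `a δ`, far `b δ`)
and `Fb` (root `b δ`, far `a δ`) for which, with probability `≥ 1 − ε`, the walk crosses some
member of `Fa` exactly once with a clean window AND (read backwards) some member of `Fb`. -/
def RenewalAccumulationAdapted : Prop :=
  ∀ (D : DobrushinDomain) (a b : ℝ → HexVertex), IsEmbEndpointApprox hexGraph hexCenter D a b →
    ∀ ε > (0 : ℝ), ∀ R > (0 : ℝ), ∃ ρ > (0 : ℝ), ∀ᶠ δ : ℝ in 𝓝[>] 0,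
      ∃ Fa Fb : Set (Set ℂ),
        IsAdmissibleFamily D.carrier δ R (a δ) (b δ) Fa ∧
        IsAdmissibleFamily D.carrier δ R (b δ) (a δ) Fb ∧
        hexSAWLaw D.carrier δ (a δ) (b δ)
            {γ | ¬ (GoodGateIn D.carrier δ ρ (a δ) Fa γ.walk.support ∧
                    GoodGateIn D.carrier δ ρ (b δ) Fb γ.walk.support.reverse)} ≤
          ENNReal.ofReal ε

/-! ## The nesting lemma (proved): disjoint + connected + two-sided + separating ⇒ nested root sides

This is the only geometric input of the "cells are products" step of stub 6 under RA‴ (and under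
the line's hexagon gates: distinct levels give disjoint arcs). -/


/-- relative closedness gives openness of the punctured set -/
theorem isOpen_sdiff_of_relClosed {Ω κ : Set ℂ} (hΩo : IsOpen Ω) (hκcl : closure κ ∩ Ω ⊆ κ) :
    IsOpen (Ω \ κ) := by
  have : Ω \ κ = Ω ∩ (closure κ)ᶜ := by
    ext z; constructor
    · rintro ⟨hz, hzκ⟩; exact ⟨hz, fun h => hzκ (hκcl ⟨h, hz⟩)⟩
    · rintro ⟨hz, hzc⟩; exact ⟨hz, fun h => hzc (subset_closure h)⟩
  rw [this]; exact hΩo.inter isClosed_closure.isOpen_compl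

/-- the complement of one component inside an open set is open (union of the other components) -/
theorem isOpen_sdiff_connectedComponentIn {F : Set ℂ} (hF : IsOpen F) (x : ℂ) :
    IsOpen (F \ connectedComponentIn F x) := by
  rw [isOpen_iff_forall_mem_open]
  rintro w ⟨hwF, hwU⟩
  refine ⟨connectedComponentIn F w, ?_, hF.connectedComponentIn, mem_connectedComponentIn hwF⟩
  intro u hu
  refine ⟨connectedComponentIn_subset _ _ hu, fun huU => hwU ?_⟩
  -- u ∈ C_w and u ∈ C_x force C_x = C_w ∋ w
  have h1 : connectedComponentIn F w = connectedComponentIn F u := connectedComponentIn_eq hu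
  have h2 : connectedComponentIn F x = connectedComponentIn F u := connectedComponentIn_eq huU
  rw [h2, ← h1]
  exact mem_connectedComponentIn hwF

/-- **Nesting lemma.**  `Ω` a preconnected open set, `κ, κ' ⊆ Ω` disjoint preconnected cuts,
relatively closed in `Ω`; `U, U'` the components of `Ω ∖ κ`, `Ω ∖ κ'` containing `root`.
If `κ` is TWO-SIDED (`W := (Ω ∖ κ) ∖ U` preconnected) with `far ∈ W`, `κ'` SEPARATES
(`far ∉ U'`), and `κ'` MEETS `U`, then `U' ⊆ U`.  (So for a walk whose prefix lies in `U` and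
crossed `κ'` earlier, "the suffix avoids `U'`" follows from "the middle piece avoids `U`":
minimality of the first good gate is prefix-determined and the cells of the gate decomposition
are products — for ANY pairwise-disjoint two-sided separating family, hexagon levels or not.) -/
theorem nesting {Ω κ κ' : Set ℂ} {root far : ℂ} (hΩo : IsOpen Ω) (hΩc : IsPreconnected Ω)
    (hκΩ : κ ⊆ Ω) (hκ'Ω : κ' ⊆ Ω) (hκc : IsPreconnected κ) (hκ'c : IsPreconnected κ')
    (hdisj : Disjoint κ κ') (hκcl : closure κ ∩ Ω ⊆ κ) (hκ'cl : closure κ' ∩ Ω ⊆ κ')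
    (hroot : root ∈ Ω) (hrκ : root ∉ κ) (hrκ' : root ∉ κ')
    (hmeet : (κ' ∩ connectedComponentIn (Ω \ κ) root).Nonempty)
    (hW : IsPreconnected ((Ω \ κ) \ connectedComponentIn (Ω \ κ) root))
    (hfarW : far ∈ (Ω \ κ) \ connectedComponentIn (Ω \ κ) root)
    (hfar' : far ∉ connectedComponentIn (Ω \ κ') root) :
    connectedComponentIn (Ω \ κ') root ⊆ connectedComponentIn (Ω \ κ) root := by
  set U := connectedComponentIn (Ω \ κ) root with hU
  set U' := connectedComponentIn (Ω \ κ') root with hU'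
  set W := (Ω \ κ) \ U with hWdef
  have hopen : IsOpen (Ω \ κ) := isOpen_sdiff_of_relClosed hΩo hκcl
  have hopen' : IsOpen (Ω \ κ') := isOpen_sdiff_of_relClosed hΩo hκ'cl
  have hUo : IsOpen U := hopen.connectedComponentIn
  have hU'o : IsOpen U' := hopen'.connectedComponentIn
  have hWo : IsOpen W := isOpen_sdiff_connectedComponentIn hopen root
  have hrootU : root ∈ U := mem_connectedComponentIn ⟨hroot, hrκ⟩
  have hrootU' : root ∈ U' := mem_connectedComponentIn ⟨hroot, hrκ'⟩
  have hUsub : U ⊆ Ω \ κ := connectedComponentIn_subset _ _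
  have hU'sub : U' ⊆ Ω \ κ' := connectedComponentIn_subset _ _
  -- Step 1: κ' ⊆ U
  have hκ'U : κ' ⊆ U := by
    obtain ⟨y, hyκ', hyU⟩ := hmeet
    have h1 : κ' ⊆ connectedComponentIn (Ω \ κ) y :=
      hκ'c.subset_connectedComponentIn hyκ' fun z hz => ⟨hκ'Ω hz, fun hzκ => hdisj.le_bot ⟨hzκ, hz⟩⟩
    rwa [← connectedComponentIn_eq hyU] at h1
  -- Step 2
  by_cases hcase : (U' ∩ κ).Nonempty
  · exfalso
    obtain ⟨z, hzU', hzκ⟩ := hcase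
    -- κ ⊆ U'
    have hκU' : κ ⊆ U' := by
      have h1 : κ ⊆ connectedComponentIn (Ω \ κ') z :=
        hκc.subset_connectedComponentIn hzκ fun w hw => ⟨hκΩ hw, fun hwκ' => hdisj.le_bot ⟨hw, hwκ'⟩⟩
      rwa [← connectedComponentIn_eq hzU'] at h1
    -- some point of κ lies in the closure of W (Ω is preconnected)
    have hclW : (κ ∩ closure W).Nonempty := by
      by_contra hno
      rw [not_nonempty_iff_eq_empty] at hno
      have hcover : Ω ⊆ W ∪ (closure W)ᶜ := by
        intro x hx
        by_cases hxκ : x ∈ κ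
        · right
          intro hxc
          have : x ∈ κ ∩ closure W := ⟨hxκ, hxc⟩
          rw [hno] at this
          exact this
        · by_cases hxU : x ∈ U
          · right
            intro hxc
            obtain ⟨w, hwU, hwW⟩ := mem_closure_iff.1 hxc U hUo hxU
            exact hwW.2 hwU
          · left
            exact ⟨⟨hx, hxκ⟩, hxU⟩
      have hdj : Disjoint W (closure W)ᶜ := disjoint_compl_right.mono_left subset_closure
      have hsub : Ω ⊆ W :=
        hΩc.subset_left_of_subset_union hWo isClosed_closure.isOpen_compl hdj hcover
          ⟨far, hfarW.1.1, hfarW⟩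
      exact (hsub hroot).2 hrootU
    obtain ⟨z₀, hz₀κ, hz₀c⟩ := hclW
    -- U' is an open neighbourhood of z₀, hence meets W
    obtain ⟨w, hwU', hwW⟩ := mem_closure_iff.1 hz₀c U' hU'o (hκU' hz₀κ)
    -- W ⊆ Ω \ κ' is preconnected and meets U', hence W ⊆ U' ∋ far: contradiction
    have hWsub : W ⊆ Ω \ κ' := fun v hv => ⟨hv.1.1, fun hvκ' => hv.2 (hκ'U hvκ')⟩
    have hWU' : W ⊆ U' := by
      have h1 : W ⊆ connectedComponentIn (Ω \ κ') w := hW.subset_connectedComponentIn hwW hWsub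
      rwa [← connectedComponentIn_eq hwU'] at h1
    exact hfar' (hWU' hfarW)
  · -- U' ⊆ Ω \ κ, preconnected, contains root
    rw [not_nonempty_iff_eq_empty] at hcase
    have hsub : U' ⊆ Ω \ κ := fun w hw => ⟨(hU'sub hw).1, fun hwκ => by
      have : w ∈ U' ∩ κ := ⟨hw, hwκ⟩
      rw [hcase] at this
      exact this⟩
    exact isPreconnected_connectedComponentIn.subset_connectedComponentIn hrootU' hsub


end Summit.CriticalPhenomena.SAWScalingLimit.Cruxes.ObservableToSLER.DrefuteRA3

end
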